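import Literature.AlgebraicGeometry.HodgeTheory.CyclicCoverPencilJointSubmersion
import Literature.AlgebraicGeometry.Motives.UniversalHypersurfaceRegularLocusLift
import Literature.Geometry.ComplexAnalytic.CyclicNodePencilRadiusCutoff
import HarnessLib

/-!
# Lifted vector fields on `𝒴°(ℂ)` tangent to the Morse shells of the nodal pencil

Family `hodge`, layer `Literature/AlgebraicGeometry/HodgeTheory`; step A1b-γ of the programme discharging
`HodgeTheory/CyclicCoverNodalMeridianLocalMonodromyBound`. For the degeneration `x₃^p = f₁ + c·x₂^p` to the one-nodal surface `x₃^p = f₁`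
(`f₁ = x₂^{p−2}x₀x₁ + x₀^p + x₁^p`) read in the chart `x₂ ≠ 0` of the regular locus `𝒴°(ℂ)` with Morse chart `Θ`, the SHELL SET `K` is the
(closed) set of points whose remaining coefficients are those of `x₃^p − f₁` and whose affine coordinates `y` lie in the Morse shell
`s₀² ≤ Σ|Θ y|² ≤ r₂²`, `|φ(y)| ≤ δ`. Every `C^∞` vector field `W` of the coefficient space lifts to a `C^∞` vector field on `𝒴°(ℂ)` which is
TANGENT TO THE MORSE SHELLS along `K` (its derivative kills the cut-off Morse radius `ρ̃ = regChartExtend (morseRadiusCutoff ∘ y)` there):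

* `shellSet`, `isClosed_shellSet`, `shellSet_subset_regChartDom` and the coordinates of its points (`mem_shellSet_coords`);
* `surjective_mfderiv_on_shellSet` — `(b, ρ̃)` is submersive along `K` (`CyclicCoverPencilJointSubmersion`);
* `exists_shell_tangent_lift` — **the lifted field: `db(X) = W(b)` everywhere, `dρ̃(X) = 0` on `K`** (`UniversalHypersurfaceRegularLocusLift`).

Everything is proved; the one definition (`shellSet`) is concrete; no named facts.

## References

* [ArnoldGuseinzadeVarchenko2012] V. I. Arnold, S. M. Gusein-Zade, A. N. Varchenko, Singularities of Differentiable Maps II (2012), Part I §1.1, §2.1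
  (the monodromy vector field is tangent to the boundary of the Milnor ball).
* [BrockerJanichIDT1982] T. Bröcker, K. Jänich, Introduction to Differential Topology (1982), (8.12).
* [CarlsonToledo1999] J. A. Carlson, D. Toledo, Duke Math. J. 97 (1999), §6 (kdoublept).
-/

noncomputable section

open CategoryTheory AlgebraicGeometry MvPolynomial TopologicalSpace Set Topology Filter
open scoped Manifold ContDiff LinearAlgebra.Projectivization
open Literature.AlgebraicGeometry.Motives Literature.AlgebraicGeometry.Motives.UniversalHypersurface
open Literature.AlgebraicGeometry.HodgeTheory.UniversalHypersurface Literature.Geometry.ComplexAnalytic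
open Literature.NumberTheory.Transcendental

namespace Literature.AlgebraicGeometry.HodgeTheory

variable (p : ℕ) (Θ : OpenPartialHomeomorph (Fin (1 + 2) → ℂ) (Fin (1 + 2) → ℂ)) (s₀ r₂ δ : ℝ)

/-- The affine shell region `C = Θ⁻¹{s₀² ≤ Σ|z|² ≤ r₂²} ∩ {|φ(y)| ≤ δ} ⊆ ℂ³`. [cite: ArnoldGuseinzadeVarchenko2012, Part I §2.1] -/
def affineShell : Set (Fin (1 + 2) → ℂ) :=
  Θ.symm '' (Θ.target ∩ {z | s₀ ^ 2 ≤ ∑ i, ‖z i‖ ^ 2 ∧ ∑ i, ‖z i‖ ^ 2 ≤ r₂ ^ 2}) ∩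
    {y | ‖y 2 ^ p - (y 0 * y 1 + y 0 ^ p + y 1 ^ p)‖ ≤ δ}

/-- The affine shell region is compact when `{Σ|z|² ≤ R'} ⊆ Θ.target` for some `R' ≥ r₂²`. [cite: ArnoldGuseinzadeVarchenko2012, Part I §2.1] -/
theorem isCompact_affineShell {R' : ℝ} (hR' : {z : Fin (1 + 2) → ℂ | ∑ i, ‖z i‖ ^ 2 ≤ R'} ⊆ Θ.target) (hr : r₂ ^ 2 ≤ R') :
    IsCompact (affineShell p Θ s₀ r₂ δ) := by
  have hA : IsCompact (Θ.target ∩ {z : Fin (1 + 2) → ℂ | s₀ ^ 2 ≤ ∑ i, ‖z i‖ ^ 2 ∧ ∑ i, ‖z i‖ ^ 2 ≤ r₂ ^ 2}) := by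
    have hsub : Θ.target ∩ {z : Fin (1 + 2) → ℂ | s₀ ^ 2 ≤ ∑ i, ‖z i‖ ^ 2 ∧ ∑ i, ‖z i‖ ^ 2 ≤ r₂ ^ 2} ⊆
        {z : Fin (1 + 2) → ℂ | ∑ i, ‖z i‖ ^ 2 ≤ R'} := fun z hz => hz.2.2.trans hr
    have hcont : Continuous fun z : Fin (1 + 2) → ℂ => ∑ i, ‖z i‖ ^ 2 := by fun_prop
    have hclosed : IsClosed (Θ.target ∩ {z : Fin (1 + 2) → ℂ | s₀ ^ 2 ≤ ∑ i, ‖z i‖ ^ 2 ∧ ∑ i, ‖z i‖ ^ 2 ≤ r₂ ^ 2}) := by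
      have heq : Θ.target ∩ {z : Fin (1 + 2) → ℂ | s₀ ^ 2 ≤ ∑ i, ‖z i‖ ^ 2 ∧ ∑ i, ‖z i‖ ^ 2 ≤ r₂ ^ 2} =
          {z : Fin (1 + 2) → ℂ | s₀ ^ 2 ≤ ∑ i, ‖z i‖ ^ 2 ∧ ∑ i, ‖z i‖ ^ 2 ≤ r₂ ^ 2} :=
        Set.inter_eq_right.mpr fun z hz => hR' (hz.2.trans hr)
      rw [heq]
      exact (isClosed_le continuous_const hcont).inter (isClosed_le hcont continuous_const)
    exact (PhamBrieskorn.isCompact_radius_le R').of_isClosed_subset hclosed hsub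
  have hAt : Θ.target ∩ {z : Fin (1 + 2) → ℂ | s₀ ^ 2 ≤ ∑ i, ‖z i‖ ^ 2 ∧ ∑ i, ‖z i‖ ^ 2 ≤ r₂ ^ 2} ⊆ Θ.target :=
    Set.inter_subset_left
  have himg := hA.image_of_continuousOn (Θ.continuousOn_symm.mono hAt)
  have hφc : Continuous fun y : Fin (1 + 2) → ℂ => ‖y 2 ^ p - (y 0 * y 1 + y 0 ^ p + y 1 ^ p)‖ := by fun_prop
  exact himg.inter_right (isClosed_le hφc continuous_const)

/-- Points of the affine shell: in the source, with the shell inequalities. [cite: ArnoldGuseinzadeVarchenko2012, Part I §2.1] -/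
theorem mem_affineShell {y : Fin (1 + 2) → ℂ} (hy : y ∈ affineShell p Θ s₀ r₂ δ) :
    y ∈ Θ.source ∧ s₀ ^ 2 ≤ ∑ i, ‖Θ y i‖ ^ 2 ∧ ∑ i, ‖Θ y i‖ ^ 2 ≤ r₂ ^ 2 ∧
      ‖y 2 ^ p - (y 0 * y 1 + y 0 ^ p + y 1 ^ p)‖ ≤ δ := by
  obtain ⟨⟨z, hz, rfl⟩, hφ⟩ := hy
  refine ⟨Θ.map_target hz.1, ?_, ?_, hφ⟩
  · rw [Θ.right_inv hz.1]; exact hz.2.1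
  · rw [Θ.right_inv hz.1]; exact hz.2.2

variable (b' : {m : DegIndex 2 p // m ≠ regPowIndex 2 p 2} → ℂ)

/-- **The shell set `K ⊆ 𝒴°(ℂ)`**: homogeneous coordinates in `stdChartInv 2 (affineShell)` and prescribed coefficients `b'` off `x₂^p`.
[cite: ArnoldGuseinzadeVarchenko2012, Part I §2.1] -/
def shellSet : Set (ComplexPoints (regularTotal ℂ 2 p)) :=
  {Q | hypersurfacePoint (regularToProjectiveSpace ℂ 2 p) Q ∈ Projectivization.stdChartInv 2 '' affineShell p Θ s₀ r₂ δ} ∩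
    {Q | ∀ m : {m : DegIndex 2 p // m ≠ regPowIndex 2 p 2}, regCoeff ℂ 2 p Q m.1 = b' m}

/-- **`K` is closed** (the image of the compact affine shell in the Hausdorff `ℙ(ℂ⁴)` is closed; the coefficients are continuous).
[cite: ArnoldGuseinzadeVarchenko2012, Part I §2.1] -/
theorem isClosed_shellSet (hd : 0 < p) {R' : ℝ} (hR' : {z : Fin (1 + 2) → ℂ | ∑ i, ‖z i‖ ^ 2 ≤ R'} ⊆ Θ.target) (hr : r₂ ^ 2 ≤ R') :
    IsClosed (shellSet p Θ s₀ r₂ δ b') := by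
  haveI : T2Space (ℙ ℂ (Fin (2 + 2) → ℂ)) := Projectivization.t2Space_pi
  have h1 : IsClosed {Q : ComplexPoints (regularTotal ℂ 2 p) |
      hypersurfacePoint (regularToProjectiveSpace ℂ 2 p) Q ∈ Projectivization.stdChartInv 2 '' affineShell p Θ s₀ r₂ δ} :=
    (((isCompact_affineShell p Θ s₀ r₂ δ hR' hr).image (Projectivization.continuous_stdChartInv 2)).isClosed).preimage
      (continuous_hypersurfacePoint _)
  have h2 : IsClosed {Q : ComplexPoints (regularTotal ℂ 2 p) |
      ∀ m : {m : DegIndex 2 p // m ≠ regPowIndex 2 p 2}, regCoeff ℂ 2 p Q m.1 = b' m} := by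
    haveI := locallyOfFiniteType_regularTotal_hom ℂ 2 p hd
    haveI := smoothOfRelativeDimension_regularTotal_hom ℂ 2 p hd
    letI := ComplexPoints.chartedSpace (regularTotal ℂ 2 p) (2 + Fintype.card (DegIndex 2 p))
    have hc : Continuous fun Q : ComplexPoints (regularTotal ℂ 2 p) => regCoeff ℂ 2 p Q :=
      continuous_iff_continuousAt.mpr fun Q => (contMDiffAt_regCoeff 2 p hd Q).continuousAt
    rw [show {Q : ComplexPoints (regularTotal ℂ 2 p) | ∀ m : {m : DegIndex 2 p // m ≠ regPowIndex 2 p 2}, regCoeff ℂ 2 p Q m.1 = b' m} =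
        ⋂ m : {m : DegIndex 2 p // m ≠ regPowIndex 2 p 2}, {Q | regCoeff ℂ 2 p Q m.1 = b' m} by ext Q; simp]
    exact isClosed_iInter fun m => isClosed_eq ((continuous_apply m.1).comp hc) continuous_const
  exact h1.inter h2

/-- **Coordinates of a point of `K`**: it lies in the chart domain, its affine coordinates `y` lie in the affine shell (in particular in
`Θ.source` with the shell inequalities), and its remaining chart coordinates are `b'`. [cite: ArnoldGuseinzadeVarchenko2012, Part I §2.1] -/
theorem mem_shellSet_coords {Q : ComplexPoints (regularTotal ℂ 2 p)} (hQ : Q ∈ shellSet p Θ s₀ r₂ δ b') :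
    Q ∈ regChartDom 2 p 2 ∧ (fun j => regChartFun 2 p 2 Q (Sum.inr j)) ∈ affineShell p Θ s₀ r₂ δ ∧
      ∀ m : {m : DegIndex 2 p // m ≠ regPowIndex 2 p 2}, regChartFun 2 p 2 Q (Sum.inl m) = b' m := by
  obtain ⟨⟨c, hc, hcQ⟩, hb⟩ := hQ
  have hdom : Q ∈ regChartDom 2 p 2 := by
    rw [regChartDom_eq_preimage, Set.mem_preimage, ← hcQ, Projectivization.stdChart_source]
    exact Projectivization.stdChartInv_mem_stdChartSource 2 c
  refine ⟨hdom, ?_, fun m => hb m⟩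
  have hy : (fun j => regChartFun 2 p 2 Q (Sum.inr j)) = c := by
    funext j
    change Projectivization.stdChart 2 (hypersurfacePoint (regularToProjectiveSpace ℂ 2 p) Q) j = c j
    rw [← hcQ, Projectivization.stdChart_apply, Projectivization.stdChartFun_stdChartInv]
  rw [hy]; exact hc

/-- **`(b, ρ̃)` is submersive along `K`** for `ρ̃ = regChartExtend (morseRadiusCutoff Θ R'' R' ∘ y)`, `p ≥ 3`, `Θ` the Morse chart data,
`0 < s₀ ≤ r₂ < 1`, `r₂^{p−2} < 2/p`, `r₂² < R'' < R'`, `{Σ|z|² ≤ R'} ⊆ Θ.target`, `δ < s₀^p`, and `b' =` the coefficients of `x₃^p − f₁` off `x₂^p`.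
[cite: ArnoldGuseinzadeVarchenko2012, Part I §2.1] [cite: CarlsonToledo1999, §6 (kdoublept)] -/
theorem surjective_mfderiv_on_shellSet (hp : 3 ≤ p)
    (hΘ : ContDiffOn ℝ ∞ Θ Θ.source) (hΘs : ContDiffOn ℝ ∞ Θ.symm Θ.target)
    (hΘφ : ∀ x ∈ Θ.source, ∑ i, (Θ x) i ^ PhamBrieskorn.cyclicNodeExponents p i = x 2 ^ p - (x 0 * x 1 + x 0 ^ p + x 1 ^ p))
    {R'' R' : ℝ} (hs₀ : 0 < s₀) (hsr : s₀ ≤ r₂) (hr₂ : r₂ < 1) (hr₂' : r₂ ^ (p - 2) < 2 / p) (hR'' : r₂ ^ 2 < R'') (hR : R'' < R')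
    (hR' : {z : Fin (1 + 2) → ℂ | ∑ i, ‖z i‖ ^ 2 ≤ R'} ⊆ Θ.target) (hδ : δ < s₀ ^ p)
    {Q : ComplexPoints (regularTotal ℂ 2 p)}
    (hQ : Q ∈ shellSet p Θ s₀ r₂ δ (fun m => coeffsOf 2 p (cyclicCoverForm p (X 2 ^ (p - 2) * (X 0 * X 1) + X 0 ^ p + X 1 ^ p)) m.1)) :
    haveI := locallyOfFiniteType_regularTotal_hom ℂ 2 p (by omega)
    haveI := smoothOfRelativeDimension_regularTotal_hom ℂ 2 p (by omega)
    letI := ComplexPoints.chartedSpace (regularTotal ℂ 2 p) (2 + Fintype.card (DegIndex 2 p))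
    Function.Surjective (mfderiv (𝓡 (2 * (2 + Fintype.card (DegIndex 2 p)))) 𝓘(ℝ, (DegIndex 2 p → ℂ) × ℝ)
      (fun Q' => (regCoeff ℂ 2 p Q',
        regChartExtend 2 p 2 (fun v => PhamBrieskorn.morseRadiusCutoff Θ R'' R' (fun j => v (Sum.inr j))) Q')) Q) := by
  obtain ⟨hdom, hyC, hb⟩ := mem_shellSet_coords p Θ s₀ r₂ δ _ hQ
  obtain ⟨hys, hlow, hup, hφ⟩ := mem_affineShell p Θ s₀ r₂ δ hyC
  have hlin : ContDiff ℝ ∞ (fun v : ChartIdx 2 p 2 → ℂ => (fun j : Fin (2 + 1) => v (Sum.inr j))) :=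
    contDiff_pi.2 fun j => contDiff_apply ℝ ℂ (Sum.inr j : ChartIdx 2 p 2)
  have hBcont : ContDiff ℝ ∞ (fun v : ChartIdx 2 p 2 → ℂ => PhamBrieskorn.morseRadiusCutoff Θ R'' R' (fun j => v (Sum.inr j))) :=
    (PhamBrieskorn.contDiff_morseRadiusCutoff Θ R'' R' hΘ hR hR').comp hlin
  have hBloc : (fun v : ChartIdx 2 p 2 → ℂ => PhamBrieskorn.morseRadiusCutoff Θ R'' R' (fun j => v (Sum.inr j))) =ᶠ[𝓝 (regChartFun 2 p 2 Q)]
      fun v => ∑ i, ‖Θ (fun j => v (Sum.inr j)) i‖ ^ 2 := by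
    have hev := PhamBrieskorn.morseRadiusCutoff_eventuallyEq Θ R'' R' hR hys (lt_of_le_of_lt hup hR'')
    have ht : Tendsto (fun v : ChartIdx 2 p 2 → ℂ => (fun j : Fin (2 + 1) => v (Sum.inr j))) (𝓝 (regChartFun 2 p 2 Q))
        (𝓝 (fun j => regChartFun 2 p 2 Q (Sum.inr j))) := hlin.continuous.continuousAt
    exact hev.comp_tendsto ht
  have hφ' : ‖(fun x : Fin (1 + 2) → ℂ => x 2 ^ p - (x 0 * x 1 + x 0 ^ p + x 1 ^ p)) (fun j => regChartFun 2 p 2 Q (Sum.inr j))‖ < s₀ ^ p :=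
    lt_of_le_of_lt hφ hδ
  exact surjective_mfderiv_regCoeff_prod_morseRadius p hp Θ hΘ hΘs hΘφ hs₀ hsr hr₂ hr₂' _ hBcont hdom hb hys hlow hup hφ' hBloc

/-- **The lifted field tangent to the Morse shells.** Under the hypotheses of `surjective_mfderiv_on_shellSet`, for every `C^∞` vector field `W`
of the coefficient space there is a `C^∞` vector field `X` on `𝒴°(ℂ)` with `db(X) = W(b)` everywhere and `dρ̃(X) = 0` on the shell set `K`,
`ρ̃ = regChartExtend 2 p 2 (morseRadiusCutoff Θ R'' R' ∘ y)`. [cite: ArnoldGuseinzadeVarchenko2012, Part I §2.1] [cite: BrockerJanichIDT1982, (8.12)] -/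
theorem exists_shell_tangent_lift (hp : 3 ≤ p)
    (hΘ : ContDiffOn ℝ ∞ Θ Θ.source) (hΘs : ContDiffOn ℝ ∞ Θ.symm Θ.target)
    (hΘφ : ∀ x ∈ Θ.source, ∑ i, (Θ x) i ^ PhamBrieskorn.cyclicNodeExponents p i = x 2 ^ p - (x 0 * x 1 + x 0 ^ p + x 1 ^ p))
    {R'' R' : ℝ} (hs₀ : 0 < s₀) (hsr : s₀ ≤ r₂) (hr₂ : r₂ < 1) (hr₂' : r₂ ^ (p - 2) < 2 / p) (hR'' : r₂ ^ 2 < R'') (hR : R'' < R')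
    (hR' : {z : Fin (1 + 2) → ℂ | ∑ i, ‖z i‖ ^ 2 ≤ R'} ⊆ Θ.target) (hδ : δ < s₀ ^ p)
    {W : (DegIndex 2 p → ℂ) → (DegIndex 2 p → ℂ)} (hW : ContDiff ℝ ∞ W) :
    haveI := locallyOfFiniteType_regularTotal_hom ℂ 2 p (by omega)
    haveI := smoothOfRelativeDimension_regularTotal_hom ℂ 2 p (by omega)
    letI := ComplexPoints.chartedSpace (regularTotal ℂ 2 p) (2 + Fintype.card (DegIndex 2 p))
    haveI := ComplexPoints.isManifold_real (regularTotal ℂ 2 p) (2 + Fintype.card (DegIndex 2 p))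
    ∃ X : Π Q : ComplexPoints (regularTotal ℂ 2 p), TangentSpace (𝓡 (2 * (2 + Fintype.card (DegIndex 2 p)))) Q,
      ContMDiff (𝓡 (2 * (2 + Fintype.card (DegIndex 2 p)))) (𝓡 (2 * (2 + Fintype.card (DegIndex 2 p)))).tangent ∞
        (fun Q => (⟨Q, X Q⟩ : TangentBundle (𝓡 (2 * (2 + Fintype.card (DegIndex 2 p)))) (ComplexPoints (regularTotal ℂ 2 p)))) ∧
      (∀ Q, mfderiv (𝓡 (2 * (2 + Fintype.card (DegIndex 2 p)))) 𝓘(ℝ, DegIndex 2 p → ℂ) (fun Q' => regCoeff ℂ 2 p Q') Q (X Q) =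
        W (regCoeff ℂ 2 p Q)) ∧
      ∀ Q ∈ shellSet p Θ s₀ r₂ δ (fun m => coeffsOf 2 p (cyclicCoverForm p (MvPolynomial.X 2 ^ (p - 2) * (MvPolynomial.X 0 * MvPolynomial.X 1) + MvPolynomial.X 0 ^ p + MvPolynomial.X 1 ^ p)) m.1),
        mfderiv (𝓡 (2 * (2 + Fintype.card (DegIndex 2 p)))) 𝓘(ℝ, ℝ)
          (regChartExtend 2 p 2 (fun v => PhamBrieskorn.morseRadiusCutoff Θ R'' R' (fun j => v (Sum.inr j)))) Q (X Q) = 0 := by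
  have hd : 0 < p := by omega
  have hlin : ContDiff ℝ ∞ (fun v : ChartIdx 2 p 2 → ℂ => (fun j : Fin (2 + 1) => v (Sum.inr j))) :=
    contDiff_pi.2 fun j => contDiff_apply ℝ ℂ (Sum.inr j : ChartIdx 2 p 2)
  have hBcont : ContDiff ℝ ∞ (fun v : ChartIdx 2 p 2 → ℂ => PhamBrieskorn.morseRadiusCutoff Θ R'' R' (fun j => v (Sum.inr j))) :=
    (PhamBrieskorn.contDiff_morseRadiusCutoff Θ R'' R' hΘ hR hR').comp hlin
  obtain ⟨R, hRb⟩ := PhamBrieskorn.exists_bound_morseRadiusCutoff Θ R'' R' hR hR'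
  have hBR : ∀ v : ChartIdx 2 p 2 → ℂ, R < ‖fun j => v (Sum.inr j)‖ →
      PhamBrieskorn.morseRadiusCutoff Θ R'' R' (fun j => v (Sum.inr j)) = 0 := fun v hv => hRb _ hv
  have hK := isClosed_shellSet p Θ s₀ r₂ δ
    (fun m => coeffsOf 2 p (cyclicCoverForm p (MvPolynomial.X 2 ^ (p - 2) * (MvPolynomial.X 0 * MvPolynomial.X 1) + MvPolynomial.X 0 ^ p + MvPolynomial.X 1 ^ p)) m.1) hd hR' (hR''.le.trans hR.le)
  exact exists_contMDiff_lift_tangent_regChartExtend 2 p 2 hd hW _ hBcont hBR hK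
    (fun Q hQ => surjective_mfderiv_on_shellSet p Θ s₀ r₂ δ hp hΘ hΘs hΘφ hs₀ hsr hr₂ hr₂' hR'' hR hR' hδ hQ)

end Literature.AlgebraicGeometry.HodgeTheory

end
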